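import Mathlib
import Summits.Ventures.HodgeRepro.PeriodCloserC7Stability
import Summits.Ventures.HodgeRepro.OcticCMPointTameSign

/-!
# OcticCMPointConjDual — the conjugate-duality identity `ε(½, ω⁻¹, ψ_δ) = ω(−1) ε(½, ω, ψ_δ)` PROVED on the model
from the conjugation

Blind re-derivation cell `pub-hodge-repro`, seat night-2 (gen 3).  Target tree path
`lean/Summits/Ventures/HodgeRepro/OcticCMPointConjDual.lean`.  Discharges the named hypothesis `ConjDual` of
`OcticCMPointTameSign.lean` (ROUTE-B §9.9 (f): «`ε(½, χ^{-1}, ψ_δ) = ε(½, χ, ψ_{−δ}) = χ(−1) ε(½, χ, ψ_δ)` by (3.29)») on gen 1's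
model `LocalChar R`, `eps κ n ω ψ = ω(ϖ)^n κ ∑_{y} ω⁻¹(y) ψ̃(y)` (Kudla Prop 3.8 (ii) / (3.32), p0109), from the conjugation
`σ` of `K_v/k_v` reduced to `R = 𝒪/𝔭^c`:

* `σ : R ≃+* R` (a ring automorphism), `ψ̃ ∘ σ = ψ̃ ∘ (s ·)` for a unit `s` (the additive character `ψ̃(y) = ψ_δ(ϖ^{−n} y)`
  with `δ̄ = −δ` transforms by the sign `s = −1 · (σ(ϖ)/ϖ)^{−n}`), `ω ∘ σ = ω⁻¹` on the units (conjugate-dual), and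
  `ω(ϖ)^{−n} = ω(t) ω(ϖ)^n` for a unit `t` (`σ(ϖ) = t ϖ`: `ω(ϖ)^{−1} = ω(σ ϖ) = ω(t) ω(ϖ)`); then
  `eps κ n ω⁻¹ ψ = ω(t s) · eps κ n ω ψ` (`eps_inv_eq_of_conjugation`), and `ConjDual` holds whenever `t s = −1`
  (`conjDual_of_conjugation`);
* the two shapes at the places of `S₃`: INERT (`𝔮 | 2`: `σ(ϖ) = ϖ`, `t = 1`, `s = −1`, `ω(ϖ)² = 1`) —
  `conjDual_inert`; RAMIFIED with a trace-zero uniformiser (`𝔭₁, 𝔭₂ | 5`: `σ(ϖ) = −ϖ`, `t = (−1)^n`, `s = (−1)^{n+1}`,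
  `ω(ϖ)² = ω(−1)`) — `conjDual_ramified`.  In both, `t s = −1`.

So, with `OcticCMPointTameSign.lean` / `GaussSumProductLocal.lean`, the local sign `ε(½, ω)` of a conjugate-dual character
is `±1` on the model with `HalfNormalised` as the only remaining normalisation hypothesis.

**What this is not.**  `σ`, `s`, `t` and the two relations are the transcription of the conjugation to the model, taken as
hypotheses (they hold for `𝒪/𝔭^c` with the stated uniformiser); the four `χ′_j` are on no page.  Nothing here says
anything about the status of the Hodge conjecture for CM abelian varieties, which is NOT proved.
-/

set_option autoImplicit false

noncomputable section

open Finset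

namespace Summit.Ventures.HodgeRepro.PeriodCloser

namespace LocalChar

variable {R : Type} [CommRing R] [Fintype R]

/-- **The Gauss sum of `ω⁻¹` from the conjugation**: if `ψ ∘ σ = ψ ∘ (s ·)` and `ω ∘ σ = ω⁻¹`, then
`𝔤(ω⁻¹) = ω(s) · 𝔤(ω)` (reindex the sum by `σ`, then by `s⁻¹ ·`). -/
theorem gauss_inv_eq_of_conjugation (ω : LocalChar R) (ψ : AddChar R ℂ) (σ : R ≃+* R) (s : Rˣ)
    (hψ : ∀ x : R, ψ (σ x) = ψ ((s : R) * x)) (hω : ∀ x : R, ω.unit (σ x) = ω.unit⁻¹ x) :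
    gauss ω⁻¹ ψ = ω.unit s * gauss ω ψ := by
  unfold gauss
  rw [inv_unit, inv_inv]
  -- `∑ x, ω(x) ψ(x) = ∑ x, ω(σ x) ψ(σ x)`
  have h1 : gaussSum ω.unit ψ = ∑ x : R, ω.unit (σ x) * ψ (σ x) :=
    (Fintype.sum_equiv σ.toEquiv _ _ fun _ => rfl).symm
  -- `= ∑ x, ω⁻¹(x) ψ(s x) = ∑ x, ω⁻¹(s⁻¹ x) ψ(x)`
  have h2a : ∑ x : R, ω.unit (σ x) * ψ (σ x) = ∑ x : R, ω.unit⁻¹ x * ψ ((s : R) * x) :=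
    sum_congr rfl fun x _ => by rw [hω, hψ]
  have h2b : ∑ x : R, ω.unit⁻¹ x * ψ ((s : R) * x) = ∑ y : R, ω.unit⁻¹ (((s⁻¹ : Rˣ) : R) * y) * ψ y := by
    refine Fintype.sum_equiv (Units.mulLeft s) _ _ fun x => ?_
    change ω.unit⁻¹ x * ψ ((s : R) * x) = ω.unit⁻¹ (((s⁻¹ : Rˣ) : R) * ((s : R) * x)) * ψ ((s : R) * x)
    rw [← mul_assoc, Units.inv_mul, one_mul]
  have h2 : ∑ x : R, ω.unit (σ x) * ψ (σ x) = ∑ x : R, ω.unit⁻¹ (((s⁻¹ : Rˣ) : R) * x) * ψ x :=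
    h2a.trans h2b
  have hs : ω.unit⁻¹ ((s⁻¹ : Rˣ) : R) = ω.unit s := by
    rw [MulChar.inv_apply_eq_inv']
    have h : ω.unit s * ω.unit ((s⁻¹ : Rˣ) : R) = 1 := by
      rw [← map_mul, Units.mul_inv, MulChar.map_one]
    exact inv_eq_of_mul_eq_one_left h
  rw [h1, h2, gaussSum, mul_sum]
  refine sum_congr rfl fun x _ => ?_
  rw [map_mul, hs]
  ring

/-- **`ε(ω⁻¹) = ω(t s) · ε(ω)`** from the conjugation data: `ψ ∘ σ = ψ ∘ (s ·)`, `ω ∘ σ = ω⁻¹`, `ω(ϖ)^{−n} = ω(t) ω(ϖ)^n`. -/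
theorem eps_inv_eq_of_conjugation (κ : ℂ) (n : ℕ) (ω : LocalChar R) (ψ : AddChar R ℂ) (σ : R ≃+* R)
    (s t : Rˣ) (hψ : ∀ x : R, ψ (σ x) = ψ ((s : R) * x)) (hω : ∀ x : R, ω.unit (σ x) = ω.unit⁻¹ x)
    (hπ : ω.piVal⁻¹ ^ n = ω.unit t * ω.piVal ^ n) :
    eps κ n ω⁻¹ ψ = ω.unit ((t : R) * s) * eps κ n ω ψ := by
  unfold eps
  rw [inv_piVal, hπ, gauss_inv_eq_of_conjugation ω ψ σ s hψ hω, map_mul]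
  ring

/-- **`ConjDual` from the conjugation**: when `t s = −1`. -/
theorem conjDual_of_conjugation (κ : ℂ) (n : ℕ) (ω : LocalChar R) (ψ : AddChar R ℂ) (σ : R ≃+* R)
    (s t : Rˣ) (hψ : ∀ x : R, ψ (σ x) = ψ ((s : R) * x)) (hω : ∀ x : R, ω.unit (σ x) = ω.unit⁻¹ x)
    (hπ : ω.piVal⁻¹ ^ n = ω.unit t * ω.piVal ^ n) (hts : (t : R) * s = -1) : ConjDual κ n ω ψ := by
  unfold ConjDual
  rw [eps_inv_eq_of_conjugation κ n ω ψ σ s t hψ hω hπ, hts]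

/-- **The inert shape** (`𝔮 | 2` of the octic point: `K_v/k_v` unramified, `ϖ ∈ k_v`, `σ(ϖ) = ϖ`): `ψ ∘ σ = ψ ∘ (−1 ·)`
(`δ̄ = −δ`), `ω ∘ σ = ω⁻¹`, `ω(ϖ)² = 1` (`ω(ϖ)^{−1} = ω(σ ϖ) = ω(ϖ)`) ⟹ `ConjDual`. -/
theorem conjDual_inert (κ : ℂ) (n : ℕ) (ω : LocalChar R) (ψ : AddChar R ℂ) (σ : R ≃+* R)
    (hψ : ∀ x : R, ψ (σ x) = ψ (-x)) (hω : ∀ x : R, ω.unit (σ x) = ω.unit⁻¹ x) (hπ2 : ω.piVal ^ 2 = 1) :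
    ConjDual κ n ω ψ := by
  refine conjDual_of_conjugation κ n ω ψ σ (-1) 1 (fun x => by rw [hψ, Units.val_neg, Units.val_one, neg_one_mul])
    hω ?_ (by rw [Units.val_one, Units.val_neg, Units.val_one, one_mul])
  rw [Units.val_one, MulChar.map_one, one_mul, inv_pow]
  have h : ω.piVal ^ n * ω.piVal ^ n = 1 := by
    rw [← mul_pow, ← sq, hπ2, one_pow]
  exact inv_eq_of_mul_eq_one_right h

/-- **The ramified shape with a trace-zero uniformiser** (`𝔭₁, 𝔭₂ | 5` of the octic point: `σ(ϖ) = −ϖ`):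
`ψ ∘ σ = ψ ∘ ((−1)^{n+1} ·)`, `ω ∘ σ = ω⁻¹`, `ω(ϖ)² = ω(−1)` (`ω(ϖ)^{−1} = ω(−ϖ) = ω(−1) ω(ϖ)`) ⟹ `ConjDual`. -/
theorem conjDual_ramified (κ : ℂ) (n : ℕ) (ω : LocalChar R) (ψ : AddChar R ℂ) (σ : R ≃+* R)
    (hψ : ∀ x : R, ψ (σ x) = ψ ((-1 : R) ^ (n + 1) * x)) (hω : ∀ x : R, ω.unit (σ x) = ω.unit⁻¹ x)
    (hπ2 : ω.piVal ^ 2 = ω.unit (-1)) : ConjDual κ n ω ψ := by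
  have hu : ω.unit (-1) * ω.unit (-1) = 1 := unit_neg_one_sq ω
  refine conjDual_of_conjugation κ n ω ψ σ ((-1) ^ (n + 1)) ((-1) ^ n)
    (fun x => by rw [hψ, Units.val_pow_eq_pow_val, Units.val_neg, Units.val_one]) hω ?_ ?_
  · -- `ω(ϖ)^{−n} = ω((−1)^n) ω(ϖ)^n`, from `ω(ϖ)² = ω(−1)`
    rw [Units.val_pow_eq_pow_val, Units.val_neg, Units.val_one, map_pow, inv_pow]
    have h : ω.piVal ^ n * (ω.unit (-1) ^ n * ω.piVal ^ n) = 1 := by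
      rw [mul_left_comm, ← mul_pow, ← sq, hπ2, ← mul_pow, hu, one_pow]
    exact inv_eq_of_mul_eq_one_right h
  · rw [Units.val_pow_eq_pow_val, Units.val_pow_eq_pow_val, Units.val_neg, Units.val_one, ← pow_add]
    rw [show n + (n + 1) = 2 * n + 1 by ring, pow_succ, pow_mul]
    simp

end LocalChar

end Summit.Ventures.HodgeRepro.PeriodCloser

end
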